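import Summits.Parity.GeneralizedHardyLittlewood.Theorems.ArtinGenericSplitNecessityDickson
import Summits.Parity.GeneralizedHardyLittlewood.Theses.SiegelSpectrumSplit

/-!
# Route `ArtinGenericSplit` — necessity package, part 2: `FixedLower → DicksonConjecture`

Cell kernel by decomp-parity lens-2 g6 (HOME/decomp-parity-lens-2/g6/ArtinGenericSplit.lean @5480cd22e7b9287d), critic CLEARED
HOME/STATUS.md l.255 / CRITIC-LEDGER row 54 (precision P1: «land §5–§7 as a Theorems hand --supports stmt-Parity-26863»);
route born rev 0 (commit 5231dbe0a256, STATUS l.300).  Landed verbatim (re-namespaced, definitions in the sibling Defs file) by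
the cell's prover-class hand seat.

This file (§5b of the kernel): a LINEAR lower bound `c·N ≤ Σ_{m ≤ N} ∏ Λ(aᵢ m + bᵢ)` forces all-prime values beyond
every bound (`exists_gt_forall_prime_of_lower`: prime powers contribute `≤ t (log X)^{t−1} (ψ − ϑ)(X) = o(N)`,
Mathlib `Chebyshev.psi_sub_theta_le`); the record leaf `FixedLower` (stmt-Parity-26863,
`Theses.SiegelSpectrumSplit.FixedLower`) at `d = 1` on the dilated system gives that lower bound
(`dickson_injective_of_fixedLower`), and deduplication of repeated forms gives
`dicksonConjecture_of_fixedLower : FixedLower → DicksonConjecture` (tree decl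
`Literature.NumberTheory.Sieve.DicksonConjecture`) — extending the translates-only
`GhostBoundaryCarving.weakDHL_of_fixedLower` to every admissible linear family.
-/

open scoped BigOperators ArithmeticFunction.vonMangoldt Chebyshev
open Finset Filter MeasureTheory Literature.NumberTheory.Sieve

namespace Summit.Parity.GeneralizedHardyLittlewood.ArtinGenericSplitNecessity

open Summit.Parity.GeneralizedHardyLittlewood.Theses.SiegelSpectrumSplit (FixedLower)

section Dickson

variable {t : ℕ}

/-- **A linear lower bound for `∑_{m ≤ N} ∏ᵢ Λ(aᵢ m + bᵢ)` forces all `aᵢ m + bᵢ` to be prime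
beyond every bound.** If every `m > M₀` has a non-prime `aᵢ m + bᵢ`, then each summand with `m > M₀`
is `≤ (log X)^{t-1} ∑ᵢ Λ(aᵢ m + bᵢ)[aᵢ m + bᵢ ∉ P]` (`X = LN`, `L = ∑ (aᵢ + bᵢ)`), so the sum is
`≤ (M₀ + 1)(log X)^t + t (log X)^{t-1} (ψ(X) − θ(X)) ≤ (M₀ + 1 + 2t)(4t)^t X^{3/4} = o(N)` by
Chebyshev's `ψ − θ ≤ 2 √X log X` and `log X ≤ 4t X^{1/(4t)}`. [folklore] -/
theorem exists_gt_forall_prime_of_lower (ht : 1 ≤ t) (a b : Fin t → ℕ) (ha : ∀ i, 1 ≤ a i)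
    {c : ℝ} (hc : 0 < c)
    (hlb : ∃ N₁ : ℕ, ∀ N : ℕ, N₁ ≤ N → c * N ≤ ∑ m ∈ range (N + 1), ∏ i, (Λ (a i * m + b i) : ℝ))
    (M₀ : ℕ) : ∃ m : ℕ, M₀ < m ∧ ∀ i, (a i * m + b i).Prime := by
  classical
  by_contra hcon
  push Not at hcon
  obtain ⟨N₁, hN₁⟩ := hlb
  obtain ⟨s, rfl⟩ : ∃ s, t = s + 1 := ⟨t - 1, by omega⟩
  -- the size `L = ∑ (aᵢ + bᵢ) ≥ 1`
  set L : ℕ := ∑ i, (a i + b i) with hL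
  have hle_L : ∀ i, a i + b i ≤ L := fun i =>
    Finset.single_le_sum (f := fun i => a i + b i) (fun i _ => Nat.zero_le _) (Finset.mem_univ i)
  have hL1 : 1 ≤ L := by have := hle_L 0; have := ha 0; omega
  have hvL : ∀ i (m N : ℕ), m ≤ N → 1 ≤ N → a i * m + b i ≤ L * N := by
    intro i m N hm hN
    calc a i * m + b i ≤ a i * N + b i * N := by nlinarith
      _ = (a i + b i) * N := by ring
      _ ≤ L * N := Nat.mul_le_mul_right N (hle_L i)
  -- constants
  set T : ℝ := ((s + 1 : ℕ) : ℝ) with hT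
  have hT1 : 1 ≤ T := by rw [hT]; exact_mod_cast Nat.succ_le_succ (Nat.zero_le s)
  have hT0 : 0 < T := by linarith
  set C₀ : ℝ := ((M₀ : ℝ) + 1 + 2 * T) * (4 * T) ^ (s + 1) with hC₀
  have hC₀0 : 0 < C₀ := by positivity
  -- the scale
  obtain ⟨N, hNN₁, hN1, hNbig⟩ : ∃ N : ℕ, N₁ ≤ N ∧ 1 ≤ N ∧ C₀ ^ 4 * (L : ℝ) ^ 3 / c ^ 4 < (N : ℝ) := by
    set C : ℝ := C₀ ^ 4 * (L : ℝ) ^ 3 / c ^ 4 with hCdef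
    refine ⟨max N₁ (max 1 (⌈C⌉₊ + 1)), le_max_left _ _,
      le_trans (le_max_left _ _) (le_max_right _ _), ?_⟩
    have h1 : C ≤ ⌈C⌉₊ := Nat.le_ceil _
    have h3 : (⌈C⌉₊ + 1 : ℕ) ≤ max N₁ (max 1 (⌈C⌉₊ + 1)) :=
      le_trans (le_max_right _ _) (le_max_right _ _)
    have h3' : ((⌈C⌉₊ + 1 : ℕ) : ℝ) ≤ ((max N₁ (max 1 (⌈C⌉₊ + 1)) : ℕ) : ℝ) := Nat.cast_le.mpr h3
    rw [Nat.cast_add, Nat.cast_one] at h3'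
    linarith
  have hN0 : (0 : ℝ) < N := by exact_mod_cast hN1
  set X : ℕ := L * N with hX
  have hXR : (X : ℝ) = (L : ℝ) * N := by rw [hX]; push_cast; ring
  have hX1 : (1 : ℝ) ≤ (X : ℝ) := by
    have : 1 ≤ L * N := Nat.one_le_iff_ne_zero.mpr (Nat.mul_ne_zero (by omega) (by omega))
    exact_mod_cast this
  have hX0 : (0 : ℝ) < X := by linarith
  have hlog0 : 0 ≤ Real.log X := Real.log_nonneg hX1
  -- each `Λ(aᵢ m + bᵢ) ≤ log X` for `m ≤ N`
  have hΛle : ∀ i (m : ℕ), m ≤ N → (Λ (a i * m + b i) : ℝ) ≤ Real.log X := by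
    intro i m hm
    refine le_trans ArithmeticFunction.vonMangoldt_le_log ?_
    rcases Nat.eq_zero_or_pos (a i * m + b i) with h0 | hpos
    · rw [h0]; simp [hlog0]
    · exact Real.log_le_log (by exact_mod_cast hpos) (by exact_mod_cast hvL i m N hm hN1)
  have hΛ0 : ∀ i (m : ℕ), (0 : ℝ) ≤ Λ (a i * m + b i) := fun i m =>
    ArithmeticFunction.vonMangoldt_nonneg
  -- the non-prime weight `g m = ∑ᵢ Λ(aᵢ m + bᵢ) [not prime]`
  set g : ℕ → ℝ := fun m =>
    ∑ i, if (a i * m + b i).Prime then (0 : ℝ) else (Λ (a i * m + b i) : ℝ) with hg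
  have hg0 : ∀ m, 0 ≤ g m := fun m => Finset.sum_nonneg fun i _ => by
    split_ifs
    · exact le_rfl
    · exact hΛ0 i m
  -- pointwise bound on the summands
  have hterm : ∀ m ∈ range (N + 1), ∏ i, (Λ (a i * m + b i) : ℝ) ≤
      (if m ≤ M₀ then Real.log X ^ (s + 1) else 0) + Real.log X ^ s * g m := by
    intro m hm
    rw [Finset.mem_range] at hm
    have hmN : m ≤ N := by omega
    have hprod_le : ∏ i, (Λ (a i * m + b i) : ℝ) ≤ Real.log X ^ (s + 1) := by
      calc ∏ i, (Λ (a i * m + b i) : ℝ) ≤ ∏ _i : Fin (s + 1), Real.log X :=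
            Finset.prod_le_prod (fun i _ => hΛ0 i m) fun i _ => hΛle i m hmN
        _ = Real.log X ^ (s + 1) := by simp
    by_cases hm0 : m ≤ M₀
    · rw [if_pos hm0]
      have : 0 ≤ Real.log X ^ s * g m := mul_nonneg (pow_nonneg hlog0 _) (hg0 m)
      linarith
    · rw [if_neg hm0, zero_add]
      obtain ⟨i₀, hi₀⟩ := hcon m (by omega)
      rw [← Finset.mul_prod_erase Finset.univ (fun i => (Λ (a i * m + b i) : ℝ))
        (Finset.mem_univ i₀)]
      have h1 : ∏ i ∈ Finset.univ.erase i₀, (Λ (a i * m + b i) : ℝ) ≤ Real.log X ^ s := by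
        calc ∏ i ∈ Finset.univ.erase i₀, (Λ (a i * m + b i) : ℝ)
            ≤ ∏ _i ∈ Finset.univ.erase i₀, Real.log X :=
              Finset.prod_le_prod (fun i _ => hΛ0 i m) fun i _ => hΛle i m hmN
          _ = Real.log X ^ s := by
              rw [Finset.prod_const, Finset.card_erase_of_mem (Finset.mem_univ i₀),
                Finset.card_univ, Fintype.card_fin, Nat.add_sub_cancel]
      have h2 : (Λ (a i₀ * m + b i₀) : ℝ) ≤ g m := by
        have : (Λ (a i₀ * m + b i₀) : ℝ) =
            (if (a i₀ * m + b i₀).Prime then (0 : ℝ) else (Λ (a i₀ * m + b i₀) : ℝ)) := by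
          rw [if_neg hi₀]
        rw [this]
        exact Finset.single_le_sum (f := fun i =>
          if (a i * m + b i).Prime then (0 : ℝ) else (Λ (a i * m + b i) : ℝ))
          (fun i _ => by
            split_ifs
            · exact le_rfl
            · exact hΛ0 i m) (Finset.mem_univ i₀)
      calc (Λ (a i₀ * m + b i₀) : ℝ) * ∏ i ∈ Finset.univ.erase i₀, (Λ (a i * m + b i) : ℝ)
          ≤ g m * Real.log X ^ s :=
            mul_le_mul h2 h1 (Finset.prod_nonneg fun i _ => hΛ0 i m) (hg0 m)
        _ = Real.log X ^ s * g m := mul_comm _ _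
  -- summing the indicator part
  have hsum_ind : ∑ m ∈ range (N + 1), (if m ≤ M₀ then Real.log X ^ (s + 1) else (0 : ℝ)) ≤
      ((M₀ : ℝ) + 1) * Real.log X ^ (s + 1) := by
    rw [← Finset.sum_filter]
    calc ∑ m ∈ (range (N + 1)).filter (fun m => m ≤ M₀), Real.log X ^ (s + 1)
        = (((range (N + 1)).filter (fun m => m ≤ M₀)).card : ℝ) * Real.log X ^ (s + 1) := by
          rw [Finset.sum_const, nsmul_eq_mul]
      _ ≤ ((M₀ : ℝ) + 1) * Real.log X ^ (s + 1) := by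
          gcongr
          have hsub : ((range (N + 1)).filter (fun m => m ≤ M₀)) ⊆ range (M₀ + 1) := by
            intro m hm
            rw [Finset.mem_filter] at hm
            rw [Finset.mem_range]; omega
          have := Finset.card_le_card hsub
          rw [Finset.card_range] at this
          exact_mod_cast this
  -- summing the non-prime part: `∑ g ≤ t (ψ X − θ X)`
  have hsum_g : ∑ m ∈ range (N + 1), g m ≤ T * (ψ X - θ X) := by
    have hi : ∀ i : Fin (s + 1), ∑ m ∈ range (N + 1),
        (if (a i * m + b i).Prime then (0 : ℝ) else (Λ (a i * m + b i) : ℝ)) ≤ ψ X - θ X := by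
      intro i
      have : ∑ m ∈ range (N + 1),
          (if (a i * m + b i).Prime then (0 : ℝ) else (Λ (a i * m + b i) : ℝ)) =
          ∑ m ∈ (range (N + 1)).filter (fun m => ¬ (a i * m + b i).Prime),
            (Λ (a i * m + b i) : ℝ) := by
        rw [Finset.sum_filter]
        refine Finset.sum_congr rfl fun m _ => ?_
        by_cases h : (a i * m + b i).Prime <;> simp [h]
      rw [this]
      exact sum_not_prime_le (a i) (b i) N X (ha i) (hvL i N N le_rfl hN1)
    calc ∑ m ∈ range (N + 1), g m
        = ∑ i : Fin (s + 1), ∑ m ∈ range (N + 1),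
            (if (a i * m + b i).Prime then (0 : ℝ) else (Λ (a i * m + b i) : ℝ)) := by
          rw [hg, Finset.sum_comm]
      _ ≤ ∑ _i : Fin (s + 1), (ψ X - θ X) := Finset.sum_le_sum fun i _ => hi i
      _ = T * (ψ X - θ X) := by
          rw [Finset.sum_const, Finset.card_univ, Fintype.card_fin, nsmul_eq_mul, hT]
  -- the total
  have hS : ∑ m ∈ range (N + 1), ∏ i, (Λ (a i * m + b i) : ℝ) ≤
      ((M₀ : ℝ) + 1) * Real.log X ^ (s + 1) + Real.log X ^ s * (T * (ψ X - θ X)) := by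
    calc ∑ m ∈ range (N + 1), ∏ i, (Λ (a i * m + b i) : ℝ)
        ≤ ∑ m ∈ range (N + 1),
            ((if m ≤ M₀ then Real.log X ^ (s + 1) else 0) + Real.log X ^ s * g m) :=
          Finset.sum_le_sum hterm
      _ = ∑ m ∈ range (N + 1), (if m ≤ M₀ then Real.log X ^ (s + 1) else (0 : ℝ)) +
            Real.log X ^ s * ∑ m ∈ range (N + 1), g m := by
          rw [Finset.sum_add_distrib, Finset.mul_sum]
      _ ≤ ((M₀ : ℝ) + 1) * Real.log X ^ (s + 1) + Real.log X ^ s * (T * (ψ X - θ X)) := by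
          gcongr
  -- Chebyshev and the elementary `log X ≤ 4t X^{1/4t}`; everything in terms of `Y = X^{1/4}`
  have hcheb : ψ X - θ X ≤ 2 * Real.sqrt X * Real.log X := Chebyshev.psi_sub_theta_le hX1
  set Y : ℝ := (X : ℝ) ^ (((4 : ℕ) : ℝ)⁻¹) with hY
  have hY4 : Y ^ 4 = X := Real.rpow_inv_natCast_pow hX0.le (by norm_num)
  have hY1 : 1 ≤ Y := Real.one_le_rpow hX1 (by positivity)
  have hY0 : 0 < Y := by linarith
  have hsqrt : Real.sqrt X = Y ^ 2 := by
    rw [← hY4, show Y ^ 4 = (Y ^ 2) ^ 2 by ring, Real.sqrt_sq (by positivity)]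
  set ε : ℝ := (((4 : ℕ) : ℝ)⁻¹) * T⁻¹ with hε
  have hε0 : 0 < ε := by positivity
  have hεinv : ε⁻¹ = 4 * T := by
    rw [hε, mul_inv, inv_inv, inv_inv]; push_cast; ring
  have hXε : ((X : ℝ) ^ ε) ^ (s + 1) = Y := by
    rw [← Real.rpow_natCast, ← Real.rpow_mul hX0.le]
    have : ε * ((s + 1 : ℕ) : ℝ) = (((4 : ℕ) : ℝ)⁻¹) := by
      rw [hε, ← hT, mul_assoc, inv_mul_cancel₀ hT0.ne', mul_one]
    rw [this]
  have hlogle : Real.log X ≤ 4 * T * (X : ℝ) ^ ε := by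
    have h := Real.log_le_rpow_div hX0.le hε0
    rw [div_eq_mul_inv, hεinv] at h
    linarith
  have hXε0 : 0 ≤ (X : ℝ) ^ ε := Real.rpow_nonneg hX0.le ε
  have hlogpow : Real.log X ^ (s + 1) ≤ (4 * T) ^ (s + 1) * Y := by
    calc Real.log X ^ (s + 1) ≤ (4 * T * (X : ℝ) ^ ε) ^ (s + 1) :=
          pow_le_pow_left₀ hlog0 hlogle _
      _ = (4 * T) ^ (s + 1) * ((X : ℝ) ^ ε) ^ (s + 1) := mul_pow _ _ _
      _ = (4 * T) ^ (s + 1) * Y := by rw [hXε]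
  have hlogpow' : Real.log X ^ s * Real.log X = Real.log X ^ (s + 1) := (pow_succ _ _).symm
  -- `∑ ∏ ≤ C₀ Y³`
  have h4T : 0 ≤ (4 * T) ^ (s + 1) * Y := by positivity
  have hmain : ∑ m ∈ range (N + 1), ∏ i, (Λ (a i * m + b i) : ℝ) ≤ C₀ * Y ^ 3 := by
    have h1 : Real.log X ^ s * (T * (ψ X - θ X)) ≤ 2 * T * Y ^ 2 * Real.log X ^ (s + 1) := by
      have : Real.log X ^ s * (T * (ψ X - θ X)) ≤
          Real.log X ^ s * (T * (2 * Real.sqrt X * Real.log X)) := by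
        gcongr
      rw [hsqrt] at this
      calc Real.log X ^ s * (T * (ψ X - θ X))
          ≤ Real.log X ^ s * (T * (2 * Y ^ 2 * Real.log X)) := this
        _ = 2 * T * Y ^ 2 * (Real.log X ^ s * Real.log X) := by ring
        _ = 2 * T * Y ^ 2 * Real.log X ^ (s + 1) := by rw [hlogpow']
    have h2 : ((M₀ : ℝ) + 1) * Real.log X ^ (s + 1) ≤ ((M₀ : ℝ) + 1) * ((4 * T) ^ (s + 1) * Y) :=
      mul_le_mul_of_nonneg_left hlogpow (by positivity)
    have h3 : 2 * T * Y ^ 2 * Real.log X ^ (s + 1) ≤ 2 * T * Y ^ 2 * ((4 * T) ^ (s + 1) * Y) :=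
      mul_le_mul_of_nonneg_left hlogpow (by positivity)
    have h4 : ((M₀ : ℝ) + 1) * ((4 * T) ^ (s + 1) * Y) ≤
        ((M₀ : ℝ) + 1) * ((4 * T) ^ (s + 1) * Y) * Y ^ 2 := by
      have : (1 : ℝ) ≤ Y ^ 2 := one_le_pow₀ hY1
      have h0 : 0 ≤ ((M₀ : ℝ) + 1) * ((4 * T) ^ (s + 1) * Y) := by positivity
      nlinarith
    calc ∑ m ∈ range (N + 1), ∏ i, (Λ (a i * m + b i) : ℝ)
        ≤ ((M₀ : ℝ) + 1) * Real.log X ^ (s + 1) + Real.log X ^ s * (T * (ψ X - θ X)) := hS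
      _ ≤ ((M₀ : ℝ) + 1) * ((4 * T) ^ (s + 1) * Y) * Y ^ 2 +
            2 * T * Y ^ 2 * ((4 * T) ^ (s + 1) * Y) := by linarith
      _ = C₀ * Y ^ 3 := by rw [hC₀]; ring
  -- contradiction with the linear lower bound
  have hlow : c * (N : ℝ) ≤ C₀ * Y ^ 3 := le_trans (hN₁ N hNN₁) hmain
  have hcN0 : 0 ≤ c * (N : ℝ) := by positivity
  have hpow4 : (c * (N : ℝ)) ^ 4 ≤ (C₀ * Y ^ 3) ^ 4 := pow_le_pow_left₀ hcN0 hlow 4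
  have hY12 : (C₀ * Y ^ 3) ^ 4 = C₀ ^ 4 * ((L : ℝ) * N) ^ 3 := by
    rw [mul_pow, ← hXR, ← hY4]; ring
  rw [hY12, mul_pow] at hpow4
  -- `c⁴ N⁴ ≤ C₀⁴ L³ N³` ⟹ `N ≤ C₀⁴ L³ / c⁴`
  have hN3 : (0 : ℝ) < (N : ℝ) ^ 3 := by positivity
  have h5 : c ^ 4 * (N : ℝ) * (N : ℝ) ^ 3 ≤ C₀ ^ 4 * (L : ℝ) ^ 3 * (N : ℝ) ^ 3 := by
    have e1 : c ^ 4 * (N : ℝ) * (N : ℝ) ^ 3 = c ^ 4 * (N : ℝ) ^ 4 := by ring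
    have e2 : C₀ ^ 4 * (L : ℝ) ^ 3 * (N : ℝ) ^ 3 = C₀ ^ 4 * ((L : ℝ) * N) ^ 3 := by ring
    rw [e1, e2]; exact hpow4
  have h6 : c ^ 4 * (N : ℝ) ≤ C₀ ^ 4 * (L : ℝ) ^ 3 := le_of_mul_le_mul_right h5 hN3
  have h7 : (N : ℝ) ≤ C₀ ^ 4 * (L : ℝ) ^ 3 / c ^ 4 := by
    rw [le_div_iff₀ (by positivity)]; linarith
  linarith

/-- **`FixedLower` gives Dickson's conjecture for injective families, beyond every bound.** Apply
the leaf at `d = 1` to `Ψ = (aᵢ n + bᵢ)ᵢ` on `K = [0, N]` (`β_∞ ≥ N`, `𝔖(Ψ) > 0` by admissibility,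
tree lemmas of `LeeYangFibresPrimeCellsRelativeDickson`) with `ε = 𝔖/4`: a linear lower bound
`∑_{m ≤ N} ∏ Λ(aᵢ m + bᵢ) ≥ (𝔖/2) N`, then `exists_gt_forall_prime_of_lower`.
[cite: GreenTao2010, Conj. 1.2 (lower half)] -/
theorem dickson_injective_of_fixedLower (hFL : FixedLower) (ht : 1 ≤ t) (a b : Fin t → ℕ)
    (ha : ∀ i, 1 ≤ a i) (hinj : Function.Injective fun i => (a i, b i))
    (hadm : ∀ p : ℕ, p.Prime → ∃ n : ℕ, ¬p ∣ ∏ i, (a i * n + b i)) (M₀ : ℕ) :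
    ∃ m : ℕ, M₀ < m ∧ ∀ i, (a i * m + b i).Prime := by
  have hnd : IsNondegenerateSystem (dsys a b) := isNondegenerateSystem_dsys a b ha hinj hadm
  have hSpos : 0 < singularProduct (dsys a b) := singularProduct_dsys_pos a b ha hinj hadm
  set S : ℝ := singularProduct (dsys a b) with hSdef
  obtain ⟨N₀, hN₀⟩ := hFL 1 t le_rfl ht (dsys a b) hnd (S / 4) (by positivity)
  have hlb : ∃ N₁ : ℕ, ∀ N : ℕ, N₁ ≤ N →
      S / 2 * N ≤ ∑ m ∈ range (N + 1), ∏ i, (Λ (a i * m + b i) : ℝ) := by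
    refine ⟨N₀, fun N hN => ?_⟩
    have h := hN₀ N hN (body N) (convex_body N) (body_subset_realBox N)
    rw [vonMangoldtSum_dsys, pow_one] at h
    have hA : (N : ℝ) ≤ archFactor (dsys a b) (body N) := le_archFactor_dsys a b ha N
    have hAS : (N : ℝ) * S ≤ archFactor (dsys a b) (body N) * S :=
      mul_le_mul_of_nonneg_right hA hSpos.le
    have hN0 : (0 : ℝ) ≤ N := Nat.cast_nonneg N
    nlinarith
  exact exists_gt_forall_prime_of_lower ht a b ha (by positivity : 0 < S / 2) hlb M₀

/-- **The leaf implies Dickson's conjecture**: `FixedLower → DicksonConjecture` (parity.S07).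
Deduplicate the family and apply `dickson_injective_of_fixedLower` (the deduplication is the tree's,
`primeCellsRelative_implies_dicksonConjecture`). [cite: Dickson1904, p. 155] -/
theorem dicksonConjecture_of_fixedLower (hFL : FixedLower) : DicksonConjecture := by
  intro k a b ha hadm
  refine Set.infinite_of_forall_exists_gt fun M₀ => ?_
  rcases Nat.eq_zero_or_pos k with hk | hk
  · subst hk
    exact ⟨M₀ + 1, fun i => Fin.elim0 i, Nat.lt_succ_self _⟩
  let F : Finset (ℕ × ℕ) := Finset.univ.image fun i => (a i, b i)
  have hFne : F.Nonempty := (Finset.image_nonempty).mpr ⟨⟨0, hk⟩, Finset.mem_univ _⟩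
  have ht1 : 1 ≤ F.card := Finset.card_pos.mpr hFne
  let e : Fin F.card ≃ {x // x ∈ F} := F.equivFin.symm
  let a' : Fin F.card → ℕ := fun j => (e j).1.1
  let b' : Fin F.card → ℕ := fun j => (e j).1.2
  have hmem : ∀ j, ∃ i, a i = a' j ∧ b i = b' j := fun j => by
    obtain ⟨i, -, hi⟩ := Finset.mem_image.mp (e j).2
    exact ⟨i, congrArg Prod.fst hi, congrArg Prod.snd hi⟩
  have hsurj : ∀ i, ∃ j, a' j = a i ∧ b' j = b i := fun i =>
    ⟨e.symm ⟨(a i, b i), Finset.mem_image_of_mem _ (Finset.mem_univ i)⟩,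
      by simp only [a', Equiv.apply_symm_apply], by simp only [b', Equiv.apply_symm_apply]⟩
  have hinj : Function.Injective fun j => (a' j, b' j) := by
    intro j j' h
    apply e.injective
    apply Subtype.ext
    exact Prod.ext (congrArg Prod.fst h) (congrArg Prod.snd h)
  have ha'1 : ∀ j, 1 ≤ a' j := fun j => by
    obtain ⟨i, hi, -⟩ := hmem j
    exact hi ▸ ha i
  have hadm' : ∀ p : ℕ, p.Prime → ∃ n : ℕ, ¬p ∣ ∏ j, (a' j * n + b' j) := fun p hp => by
    obtain ⟨n, hn⟩ := hadm p hp
    refine ⟨n, fun hdvd => hn ?_⟩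
    obtain ⟨j, -, hj⟩ := (Nat.Prime.prime hp).exists_mem_finset_dvd hdvd
    obtain ⟨i, hi1, hi2⟩ := hmem j
    rw [← hi1, ← hi2] at hj
    exact hj.trans (Finset.dvd_prod_of_mem (fun i => a i * n + b i) (Finset.mem_univ i))
  obtain ⟨m, hm, hprime⟩ := dickson_injective_of_fixedLower hFL ht1 a' b' ha'1 hinj hadm' M₀
  refine ⟨m, fun i => ?_, hm⟩
  obtain ⟨j, hj1, hj2⟩ := hsurj i
  rw [← hj1, ← hj2]
  exact hprime j

end Dickson

end Summit.Parity.GeneralizedHardyLittlewood.ArtinGenericSplitNecessity
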